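import Literature.MathematicalPhysics.QuantumFieldTheory.Balaban1983to89.B15Claim189Cases
import Literature.MathematicalPhysics.QuantumFieldTheory.Balaban1983to89.B8Eq17ClassAkV1

/-!
# `Balaban1983to89.B15Chi124DetSets` — T. Bałaban, *Large field renormalization. I. The basic step of the 𝐑 operation*,
# Commun. Math. Phys. **122** (1989) 175–202 [Balaban1989LargeFieldI] = [IV], (1.22)–(1.24) pp. 181–182: the INDUCTIVE CHARACTERISTIC
# FUNCTIONS `χ_k^{(0)}`, `χ_k^{(1)}`, `χ_k^{(n)}` AS FUNCTIONALS OF A CONFIGURATION ON THE CONCRETE REGIONS `Ω_j`, `Z″_j` of the multi-scale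
# point-set model (`B15DeterminingSets`), with the plaquette-set convention of [I] p. 251 (`B8Eq17ClassAkV1.plaqsOf`)

statement-level skeleton of published theorems with citation tags; proofs where landed; nothing here is a claim
about the Yang–Mills mass gap

PDF held: `paper:balaban1989-cmp122-large-field-i` (journal page = PDF page + 174); (1.22)–(1.23) p. 181 [PDF 7] and (1.24) pp. 181–182
[PDF 7–8] READ AS IMAGES on the ×2 renders `run/shared/lean/pub/pub-balaban/b2b-balaban-ref1/pages/1989-cmp122-large-field-I/…-p007-x2.png`,
`…-p008-x2.png` (the text layer of (1.24) is garbled).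

CITATION HEADER / WHAT IS REPRODUCED (lean-in-tree rule 2026-08-18).  Mega-formalization `lit-balaban`, HOME `run/shared/lean/pub/lit-balaban/`,
unit `lit-balaban-r12` gen 12 (reader/typer and fold owner of block B15).  SKELETON rows **B15.Eq1.22**, **B15.Eq1.23**, **B15.Eq1.24** (cells;
heads unchanged: the displays were typed in gen 1 as the schematic leaves `B15.PrelimIntegrations.SF122`/`SF123`/`SF124c` (plaquette sets as
parameters) and `B15.BasicStep.SF149`/`SF151` (schematic reals)); item **A3** of the cell's definitions register (`lit-balaban-r20/DEFINITIONS.md`: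
«B15 (1.3)/(1.24): the characteristic functions on the multi-scale point-set model» — the point-set model is `B15DeterminingSets` (r12 gen 2/4:
regions `Ω_j`, `Z`, `Z″_j` as subsets of the fine lattice `Site P 0`), THIS FILE supplies the characteristic functions ON it).

THE PRINT (verbatim, p. 181 [PDF 7]): *"We start with the decomposition of unity 1 = χ_k^{(0)} + (1 − χ_k^{(0)}), where χ_k^{(0)} = χ({|U^{(0)}_{k,Z}(∂p) − 1|
< (1 − β½)ε_h(L^{k−h}η)² for p ∈ Ω_h∖Ω_{h+1}}). (1.22) … the next decomposition of unity 1 = χ_k^{(1)} + (1 − χ_k^{(1)}) in components of Z, where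
χ_k^{(1)} = χ({|U^{(1)}_{k,Z}(∂p) − 1| < (1 − β(½ + 1/2²))ε_h(L^{k−h}η)² for p ∈ Z″_{h+1}∩Ω_h, |U^{(1)}_{k,Z}(∂p) − 1| < (1 − β½)ε_{h+1}(L^{k−h−1}η)² for
p ∈ Ω^c_{h+2}∖Z″_{h+1}}). (1.23) … We assume, that after n integrations the only characteristic functions which remain, and which are connected
with these integrations, are χ_k^{(n)}χ_h(Z_h∩Ω_h). The definition of χ_k^{(n)} is rather complicated, and it has a different form for j = h + n
≦ k₀ = k − N₀, and for j > k₀. In the first case the integration regions are disjoint, and the functions are defined by generalizations of (1.22)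
and (1.23). In the second case some integration regions overlap … We write the definition in the second case,"* (pp. 181–182 [PDF 7–8]):
*"χ_k^{(n)} = χ({|U^{(n)}_{k,Z}(∂p) − 1| < (1 − β(1 − 2^{−(j−h+1)}))ε_h(L^{k−h}η)² for p ∈ Z″_{h+1}∩Ω_h, |…| < (1 − β(1 − 2^{−(j−h)}))ε_{h+1}(L^{k−h−1}η)² for
p ∈ Z″_{h+2}∖Z″_{h+1}, ……, |…| < (1 − β(1 − 2^{−(j−k₀+1)}))ε_{k₀}(L^{k−k₀}η)² for p ∈ Z″_{k₀+1}∖Z″_{k₀}, |…| < (1 − β(1 − 2^{−(j−k₀)}))ε_{k₀+1}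
(L^{k−k₀−1}η)² for p ∈ Z″_{k₀+2}∖Z″_{k₀+1}, |…| < (1 − β(1 − 2^{−(j−k₀−1)}))L₀²ε_{k₀+2}(L^{k−k₀−2}η)² for p ∈ Z″_{k₀+3}∖Z″_{k₀+2}, ……, |…| <
(1 − β(1 − 2^{−2}))L₀^{2(j−k₀−2)}ε_{j−1}(L^{k−j+1}η)² for p ∈ Z″_j∖Z″_{j−1}, |…| < (1 − β½)L₀^{2(j−k₀−1)}ε_j(L^{k−j}η)² for p ∈ Ω^c_{k₀+1}∖Z″_j, |…| <
(1 − β½)L₀^{2(j−k₀−2)}ε_j(L^{k−j}η)² for p ∈ Ω_{k₀+1}∖Ω_{k₀+2}, ……, |…| < (1 − β½)L₀²ε_j(L^{k−j}η)² for p ∈ Ω_{j−2}∖Ω_{j−1}, |…| < c(1 − β½)ε_j(L^{k−j}η)²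
for p ∈ Ω_{j−1}∖Ω_{j+1}}), (1.24) where c = 1 for j < k, and c = 3 for j = k. We choose the number β satisfying 0 < β ≦ 1/2 … The number L₀
satisfies 2 ≦ L₀ < ½L"*.

READING (declared, not printed).  (a) The four KINDS of lines of (1.24) as index ranges: the `Z″`-lines *"for p ∈ Z″_{i+1}∖Z″_i"*,
`i = h, …, j − 1` (the `i = h` member being `Z″_{h+1} ∩ Ω_h`), threshold `(1 − β(1 − 2^{−(j−i+1)}))·L₀^{2max{0, i−k₀−1}}·ε_i(L^{k−i}η)²` — exactly the
schematic leaf `B15.BasicStep.SF149` with `t = 2^{−(j−i+1)}`, `L0pow = (L₀²)^{i−k₀−1}` (natural subtraction = `max{0, ·}`, as in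
`B15Claim189Cases.lines124N_of_bounds`), `εE = ε_i(L^{k−i}η)²`; the outer line *"for p ∈ Ω^c_{k₀+1}∖Z″_j"* and the `Ω`-lines *"for p ∈
Ω_l∖Ω_{l+1}"*, `l = k₀ + 1, …, j − 2`, threshold `(1 − β½)L₀^{2(j−l−1)}ε_j(L^{k−j}η)²` (`l = k₀` for the outer line) — the leaf `SF151`; the top line
*"for p ∈ Ω_{j−1}∖Ω_{j+1}"* — the leaf `B15.PrelimIntegrations.SF124c` with `c = cTop j k`.  The display lists distinct lines when `j ≧ k₀ + 3`;
for `k₀ < j ≦ k₀ + 2` the ranges degenerate as written (empty `Ω`-range; at `j = k₀ + 1` the outer line and the top line both meet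
`Ω_{k₀}∖Ω_{k₀+1}` outside `Z″_j`, and the conjunction there is the `c`-free line) — print does not spell these cases out; recorded, not
resolved.  (b) *"p ∈ X"* for a region `X ⊂ T_η` (a union of big cubes) is read with the cell's convention [I] p. 251 ∕ [10] p. 77 *"the set of
bonds … which intersect it. Similarly for the corresponding set of plaquettes"*: `B8Eq17ClassAkV1.plaqsOf X` = the plaquettes with at least one
corner in `X`; a plaquette meeting two regions carries both conditions (harmless for a conjunction of small-plaquette conditions; print
silent).  (c) The configuration `U^{(n)}_{k,Z}` is a gauge field on the fine lattice `T_η = Site P 0` of `Setup` (as in `B15DeterminingSets`);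
`|U(∂p) − 1| = dist1 (plaqHol U p)`.  (d) ONLY THE SECOND CASE `j > k₀` is displayed in print and only it is typed as `Chi124`; the first case
(*"generalizations of (1.22) and (1.23)"*) is not displayed and is NOT reconstructed here — its members `n = 0, 1` ARE displayed and are typed
(`chi122`, `chi123`, on the concrete regions, through the gen-1 leaves `SF122`/`SF123`).

WHAT THIS FILE PROVIDES.  §1 DEFINITIONS with bodies: `E124` (`ε_i(L^{k−i}η)²`), `region149` (the `Z″`-line regions), **`Chi124`** (χ_k^{(n)},
second case, as the conjunction of the located lines over `plaqsOf` of the concrete regions, each line literally a gen-1 leaf `SF149`/`SF151`/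
`SF124c` at `dev := dist1 (plaqHol U p)`), `chi122`, `chi123`.  §2 API (proved): the unfoldings `chi124_iff` (each line = `Setup.PlaqSmallOn` at
the explicit threshold), `chi122_iff`/`chi123_iff`, `plaqHol_one`, **`chi124_one`** (non-vacuity: the trivial configuration `U ≡ 1` satisfies
`Chi124` as soon as every threshold is positive — `0 < β ≦ 1/2`, `1 ≦ L₀`, `0 < ε_i`, `L, η ≠ 0`), `chi124_mono_plaqs` (restriction to smaller
regions).  §3 KNIT with gen 7 (`B15Claim189Cases`): **`chi124_top_of_lines`** — at `n = N` (`j = k`, `N₀ = k − k₀ ≧ 2`) the five line-families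
concluded by `lines124N_of_bounds` (on plaquette families covering the concrete regions, the `Z″_{h+1}∩Ω_h` region covered by the two p. 200
pieces) give `Chi124 … k k`, i.e. the function `χ″_k` of (1.88)/(1.89) IS `Chi124` at `j = k`; `claim189_chi124` — (1.89) in the typed form
`B15.BasicStep.Claim189 remaining (Chi124 …)` from the chain hypothesis of `claim189_of_chain`.
HONEST SCOPE.  Definitions + unfoldings + one non-vacuity witness + a bookkeeping knit; nothing printed is asserted as a fact; no integral,
no decomposition of unity as an operation on densities (the words *"we introduce this decomposition in each component of Z separately … we
exclude them from the region Z"* are the 𝐑-operation bookkeeping of `B15BasicStep`/`B15Sect1Statements`, not typed here).  Imports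
`B15Claim189Cases` (r12 gen 7) and `B8Eq17ClassAkV1` (p40; for `plaqsOf`, which already imports `B15DeterminingSets`); re-declares nothing.
v1.1 (r12 gen 21, draft of gen 14; 2026-08-22): CITELOC DOCFIX ONLY — the locator «(9) p.19» of `plaqHol_one` now reads «(9) p.18»
([Balaban1985Averaging], CMP 98: display (9), the contour holonomy U(Γ) = Π U(⟨x_i, x_{i+1}⟩), and the sentence «U(∂p) is defined by (9)» are on
p. 18 = PDF p. 2, ll. 36–43; p. 19 opens with «The renormalization group transformations are integral operators …»; CITELOC-SWEEP-g14 §9,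
re-verified on the text layer `paper:balaban1985-cmp98-averaging` this gen); no declaration, statement or proof changed.
-/

open Set

namespace Literature.MathematicalPhysics.QuantumFieldTheory.Balaban1983to89.B15Chi124DetSets

open Literature.MathematicalPhysics.QuantumFieldTheory.Balaban1983to89
open B15.PrelimIntegrations B15.BasicStep B8Eq17ClassAkV1 GaugeField

variable {P : Params} {G : Type*} [GaugeGroup G]

/-! ## §1 The definitions -/

/-- The basic small-field unit of scale `i` seen from step `k`: `ε_i(L^{k−i}η)²` (the right-hand factor of every line of (1.22)–(1.24)).
[cite: Balaban1989LargeFieldI, (1.24) p.182, (1.3) p.178] -/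
noncomputable def E124 (ε : ℕ → ℝ) (L η : ℝ) (k i : ℕ) : ℝ := ε i * (L ^ (k - i) * η) ^ 2

/-- The regions of the `Z″`-lines of (1.24): `Z″_{h+1} ∩ Ω_h` for `i = h`, `Z″_{i+1}∖Z″_i` for `i > h` (subsets of the fine lattice, as in
`B15DeterminingSets`: `Ω j`, `Zpp j ⊂ Site P 0`). [cite: Balaban1989LargeFieldI, (1.24) pp.181–182] -/
def region149 (Ω Zpp : ℕ → Set (Site P 0)) (h i : ℕ) : Set (Site P 0) :=
  if i = h then Zpp (h + 1) ∩ Ω h else Zpp (i + 1) \ Zpp i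

/-- **(1.24), second case `j = h + n > k₀ = k − N₀`** — the characteristic function `χ_k^{(n)}` as a predicate on the configuration
`U = U^{(n)}_{k,Z}` of the fine lattice: the conjunction of (i) the `Z″`-lines *"|U(∂p) − 1| < (1 − β(1 − 2^{−(j−i+1)}))L₀^{2max{0,i−k₀−1}}ε_i(L^{k−i}η)²
for p ∈ Z″_{i+1}∖Z″_i"* (`Z″_{h+1}∩Ω_h` for `i = h`), `h ≦ i < j` — the leaf `SF149`; (ii) the outer line *"(1 − β½)L₀^{2(j−k₀−1)}ε_j(L^{k−j}η)² for
p ∈ Ω^c_{k₀+1}∖Z″_j"* and (iii) the `Ω`-lines *"(1 − β½)L₀^{2(j−l−1)}ε_j(L^{k−j}η)² for p ∈ Ω_l∖Ω_{l+1}"*, `k₀ < l ≦ j − 2` — the leaf `SF151`;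
(iv) the top line *"c(1 − β½)ε_j(L^{k−j}η)² for p ∈ Ω_{j−1}∖Ω_{j+1}"*, `c = cTop j k` — the leaf `SF124c`; plaquette sets by `plaqsOf` ([I] p. 251
convention). [cite: Balaban1989LargeFieldI, (1.24) pp.181–182] -/
def Chi124 (Ω Zpp : ℕ → Set (Site P 0)) (h k₀ j k : ℕ) (β L₀ : ℝ) (ε : ℕ → ℝ) (L η : ℝ) (U : GaugeField P 0 G) : Prop :=
  (∀ i, h ≤ i → i < j → ∀ p ∈ plaqsOf (region149 Ω Zpp h i),
      SF149 (dist1 (plaqHol U p)) β ((1 / 2 : ℝ) ^ (j - i + 1)) ((L₀ ^ 2) ^ (i - k₀ - 1)) (E124 ε L η k i)) ∧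
  (∀ p ∈ plaqsOf ((Ω (k₀ + 1))ᶜ \ Zpp j), SF151 (dist1 (plaqHol U p)) β ((L₀ ^ 2) ^ (j - k₀ - 1)) (E124 ε L η k j)) ∧
  (∀ l, k₀ < l → l + 2 ≤ j → ∀ p ∈ plaqsOf (Ω l \ Ω (l + 1)),
      SF151 (dist1 (plaqHol U p)) β (L₀ ^ (2 * (j - l - 1))) (E124 ε L η k j)) ∧
  (∀ p ∈ plaqsOf (Ω (j - 1) \ Ω (j + 1)), SF124c (dist1 (plaqHol U p)) (cTop j k) β (E124 ε L η k j))

/-- **(1.22)** `χ_k^{(0)}` ON THE CONCRETE REGION `Ω_h∖Ω_{h+1}`: the gen-1 leaf `SF122` at the plaquette set `plaqsOf (Ω_h∖Ω_{h+1})`,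
`Lpow = L^{k−h}`. [cite: Balaban1989LargeFieldI, (1.22) p.181] -/
def chi122 (Ω : ℕ → Set (Site P 0)) (h k : ℕ) (β : ℝ) (ε : ℕ → ℝ) (L η : ℝ) (U : GaugeField P 0 G) : Prop :=
  SF122 (plaqsOf (Ω h \ Ω (h + 1))) β (ε h) (L ^ (k - h)) η U

/-- **(1.23)** `χ_k^{(1)}` ON THE CONCRETE REGIONS `Z″_{h+1}∩Ω_h` and `Ω^c_{h+2}∖Z″_{h+1}`: the gen-1 leaf `SF123` at the plaquette sets
`plaqsOf (Z″_{h+1}∩Ω_h)`, `plaqsOf (Ω^c_{h+2}∖Z″_{h+1})`, `Lpow = L^{k−h}`. [cite: Balaban1989LargeFieldI, (1.23) p.181] -/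
def chi123 (Ω Zpp : ℕ → Set (Site P 0)) (h k : ℕ) (β : ℝ) (ε : ℕ → ℝ) (L η : ℝ) (U : GaugeField P 0 G) : Prop :=
  SF123 (plaqsOf (Zpp (h + 1) ∩ Ω h)) (plaqsOf ((Ω (h + 2))ᶜ \ Zpp (h + 1))) β (ε h) (ε (h + 1)) (L ^ (k - h)) L η U

/-! ## §2 Unfoldings, monotonicity, non-vacuity -/

/-- The `i = h` region of the `Z″`-lines is `Z″_{h+1} ∩ Ω_h`. [cite: Balaban1989LargeFieldI, (1.24) p.181] -/
@[simp] theorem region149_self (Ω Zpp : ℕ → Set (Site P 0)) (h : ℕ) : region149 Ω Zpp h h = Zpp (h + 1) ∩ Ω h := by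
  simp [region149]

/-- The `i > h` regions of the `Z″`-lines are `Z″_{i+1}∖Z″_i`. [cite: Balaban1989LargeFieldI, (1.24) pp.181–182] -/
theorem region149_of_ne (Ω Zpp : ℕ → Set (Site P 0)) {h i : ℕ} (hi : i ≠ h) : region149 Ω Zpp h i = Zpp (i + 1) \ Zpp i := by
  simp [region149, hi]

/-- **(1.24) unfolded**: every line is the small-plaquette condition `Setup.PlaqSmallOn` on the plaquettes of its region at the printed
threshold. [cite: Balaban1989LargeFieldI, (1.24) pp.181–182] -/
theorem chi124_iff (Ω Zpp : ℕ → Set (Site P 0)) (h k₀ j k : ℕ) (β L₀ : ℝ) (ε : ℕ → ℝ) (L η : ℝ) (U : GaugeField P 0 G) :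
    Chi124 Ω Zpp h k₀ j k β L₀ ε L η U ↔
      (∀ i, h ≤ i → i < j → PlaqSmallOn (plaqsOf (region149 Ω Zpp h i))
          ((1 - β * (1 - (1 / 2 : ℝ) ^ (j - i + 1))) * (L₀ ^ 2) ^ (i - k₀ - 1) * E124 ε L η k i) U) ∧
      PlaqSmallOn (plaqsOf ((Ω (k₀ + 1))ᶜ \ Zpp j)) ((1 - β / 2) * (L₀ ^ 2) ^ (j - k₀ - 1) * E124 ε L η k j) U ∧
      (∀ l, k₀ < l → l + 2 ≤ j → PlaqSmallOn (plaqsOf (Ω l \ Ω (l + 1)))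
          ((1 - β / 2) * L₀ ^ (2 * (j - l - 1)) * E124 ε L η k j) U) ∧
      PlaqSmallOn (plaqsOf (Ω (j - 1) \ Ω (j + 1))) (cTop j k * (1 - β / 2) * E124 ε L η k j) U :=
  Iff.rfl

/-- **(1.22) unfolded**: `PlaqSmallOn (plaqsOf (Ω_h∖Ω_{h+1})) ((1 − β½)ε_h(L^{k−h}η)²)`. [cite: Balaban1989LargeFieldI, (1.22) p.181] -/
theorem chi122_iff (Ω : ℕ → Set (Site P 0)) (h k : ℕ) (β : ℝ) (ε : ℕ → ℝ) (L η : ℝ) (U : GaugeField P 0 G) :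
    chi122 Ω h k β ε L η U ↔ PlaqSmallOn (plaqsOf (Ω h \ Ω (h + 1))) ((1 - β / 2) * E124 ε L η k h) U := by
  simp only [chi122, SF122, E124, mul_assoc]

/-- **(1.23) unfolded**: the two small-plaquette conditions at `(1 − β(½ + ¼))ε_h(L^{k−h}η)²` and `(1 − β½)ε_{h+1}(L^{k−h−1}η)²` (the latter
for `h < k` and `L ≠ 0`, so that `L^{k−h}/L = L^{k−h−1}`). [cite: Balaban1989LargeFieldI, (1.23) p.181] -/
theorem chi123_iff (Ω Zpp : ℕ → Set (Site P 0)) {h k : ℕ} (hhk : h < k) (β : ℝ) (ε : ℕ → ℝ) {L : ℝ} (hL : L ≠ 0) (η : ℝ)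
    (U : GaugeField P 0 G) :
    chi123 Ω Zpp h k β ε L η U ↔
      PlaqSmallOn (plaqsOf (Zpp (h + 1) ∩ Ω h)) ((1 - β * (1 / 2 + 1 / 2 ^ 2)) * E124 ε L η k h) U ∧
      PlaqSmallOn (plaqsOf ((Ω (h + 2))ᶜ \ Zpp (h + 1))) ((1 - β / 2) * E124 ε L η k (h + 1)) U := by
  have hpow : L ^ (k - h) / L = L ^ (k - (h + 1)) := by
    have hk : k - h = (k - (h + 1)) + 1 := by omega
    rw [hk, pow_succ, mul_div_assoc, div_self hL, mul_one]
  simp only [chi123, SF123, E124, mul_assoc, hpow]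

/-- Restriction: `Chi124` is monotone under shrinking the regions' plaquette families — if every region of a second family of regions has
its plaquettes among those of the first, the first `χ` implies the second (used when components are excluded from `Z`, p. 181 *"we exclude
them from the region Z … We denote the union of components with functions χ_k^{(0)} by Z again"*). [cite: Balaban1989LargeFieldI, (1.22)–(1.24) pp.181–182] -/
theorem chi124_mono_plaqs {Ω Zpp Ω' Zpp' : ℕ → Set (Site P 0)} {h k₀ j k : ℕ} {β L₀ : ℝ} {ε : ℕ → ℝ} {L η : ℝ}
    (hZ : ∀ i, h ≤ i → i < j → plaqsOf (P := P) (region149 Ω' Zpp' h i) ⊆ plaqsOf (region149 Ω Zpp h i))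
    (hOut : plaqsOf (P := P) ((Ω' (k₀ + 1))ᶜ \ Zpp' j) ⊆ plaqsOf ((Ω (k₀ + 1))ᶜ \ Zpp j))
    (hΩ : ∀ l, k₀ < l → l + 2 ≤ j → plaqsOf (P := P) (Ω' l \ Ω' (l + 1)) ⊆ plaqsOf (Ω l \ Ω (l + 1)))
    (hTop : plaqsOf (P := P) (Ω' (j - 1) \ Ω' (j + 1)) ⊆ plaqsOf (Ω (j - 1) \ Ω (j + 1)))
    {U : GaugeField P 0 G} (hU : Chi124 Ω Zpp h k₀ j k β L₀ ε L η U) : Chi124 Ω' Zpp' h k₀ j k β L₀ ε L η U := by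
  obtain ⟨h1, h2, h3, h4⟩ := hU
  exact ⟨fun i hi hij p hp => h1 i hi hij p (hZ i hi hij hp), fun p hp => h2 p (hOut hp),
    fun l hl hlj p hp => h3 l hl hlj p (hΩ l hl hlj hp), fun p hp => h4 p (hTop hp)⟩

/-- The trivial configuration has trivial plaquette variables: `1(∂p) = 1`. [cite: Balaban1985Averaging, (9) p.18] -/
theorem plaqHol_one {j : ℕ} (p : Plaq P j) : plaqHol (1 : GaugeField P j G) p = 1 := by
  show (1 : G) * 1 * (1 : G)⁻¹ * (1 : G)⁻¹ = 1
  simp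

/-- **NON-VACUITY of (1.24)**: the trivial configuration `U ≡ 1` satisfies `χ_k^{(n)}` as soon as every threshold is positive — which holds
for print's parameters `0 < β ≦ 1/2`, `2 ≦ L₀` (here: `β ≦ 1/2`, `1 ≦ L₀`), positive `ε_i` and nonzero `L`, `η`.
[cite: Balaban1989LargeFieldI, (1.24) p.182 («We choose the number β satisfying 0 < β ≦ 1/2 … 2 ≦ L₀ < ½L»)] -/
theorem chi124_one (Ω Zpp : ℕ → Set (Site P 0)) (h k₀ j k : ℕ) {β L₀ : ℝ} (hβ : β ≤ 1 / 2) (hL₀ : 1 ≤ L₀)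
    {ε : ℕ → ℝ} (hε : ∀ i, 0 < ε i) {L η : ℝ} (hL : L ≠ 0) (hη : η ≠ 0) :
    Chi124 Ω Zpp h k₀ j k β L₀ ε L η (1 : GaugeField P 0 G) := by
  have hE : ∀ i, 0 < E124 ε L η k i := fun i => by
    unfold E124
    exact mul_pos (hε i) (by positivity)
  have hβ2 : 0 < 1 - β / 2 := by linarith
  have hL₀' : 0 < L₀ := by linarith
  refine ⟨fun i _ _ p _ => ?_, fun p _ => ?_, fun l _ _ p _ => ?_, fun p _ => ?_⟩
  · simp only [SF149, plaqHol_one, GaugeGroup.dist1_one]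
    have ht : (0 : ℝ) ≤ (1 / 2 : ℝ) ^ (j - i + 1) := by positivity
    have ht1 : (1 / 2 : ℝ) ^ (j - i + 1) ≤ 1 := pow_le_one₀ (by norm_num) (by norm_num)
    have hc : 0 < 1 - β * (1 - (1 / 2 : ℝ) ^ (j - i + 1)) := by nlinarith
    exact mul_pos (mul_pos hc (by positivity)) (hE i)
  · simp only [SF151, plaqHol_one, GaugeGroup.dist1_one]
    exact mul_pos (mul_pos hβ2 (by positivity)) (hE j)
  · simp only [SF151, plaqHol_one, GaugeGroup.dist1_one]
    exact mul_pos (mul_pos hβ2 (by positivity)) (hE j)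
  · simp only [SF124c, plaqHol_one, GaugeGroup.dist1_one]
    have hc : 0 < cTop j k := by unfold cTop; split_ifs <;> norm_num
    exact mul_pos (mul_pos hc hβ2) (hE j)

/-! ## §3 The knit with the (1.89) bookkeeping of `B15Claim189Cases`: `χ″_k` IS `Chi124` at `j = k` -/

/-- **`χ″_k = χ_k^{(N)}` IS `Chi124` AT `j = k`** (p. 182 *"basic properties of χ_k^{(n)} are simple. They will be described for n = N, i.e.,
for j = k"*; (1.88)/(1.89)): if the five line-families of (1.24) at `n = N` hold in the shapes CONCLUDED by
`B15Claim189Cases.lines124N_of_bounds` — on plaquette families `SΩ m`, `SOut`, `SZ i`, `Shalf` that CONTAIN the plaquettes of the concrete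
regions (`Ω_m∖Ω_{m+1}` for `k₀ < m ≦ k − 2`, the top region `Ω_{k−1}∖Ω_{k+1}`, `Ω^c_{k₀+1}∖Z″_k`, `Z″_{i+1}∖Z″_i` for `h < i < k`, and `Z″_{h+1}∩Ω_h`
covered by the two p. 200 pieces `SZ h ∪ Shalf`) — then `Chi124 Ω Zpp h k₀ k k β L₀ ε L η U`.  Here `N₀ = k − k₀ ≧ 2` (p. 200: the top domain
`Ω_{k−1}` is one of the `Ω_m`, `k₀ < m`), `t_i = 2^{−(k−i+1)}`, `E_i = ε_i(L^{k−i}η)²`. Bookkeeping. [cite: Balaban1989LargeFieldI, (1.24) p.182, (1.89) p.198, p.200] -/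
theorem chi124_top_of_lines (Ω Zpp : ℕ → Set (Site P 0)) {h k₀ k : ℕ} (hk : k₀ + 2 ≤ k) {β L₀ : ℝ} {ε : ℕ → ℝ} {L η : ℝ}
    (U : GaugeField P 0 G) (SΩ : ℕ → Set (Plaq P 0)) (SOut : Set (Plaq P 0)) (SZ : ℕ → Set (Plaq P 0)) (Shalf : Set (Plaq P 0))
    -- the families contain the plaquettes of the concrete regions
    (hSΩ : ∀ m, k₀ < m → m + 2 ≤ k → plaqsOf (Ω m \ Ω (m + 1)) ⊆ SΩ m)
    (hStop : plaqsOf (Ω (k - 1) \ Ω (k + 1)) ⊆ SΩ (k - 1))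
    (hSOut : plaqsOf ((Ω (k₀ + 1))ᶜ \ Zpp k) ⊆ SOut)
    (hSZ : ∀ i, h < i → i < k → plaqsOf (Zpp (i + 1) \ Zpp i) ⊆ SZ i)
    (hSh : plaqsOf (Zpp (h + 1) ∩ Ω h) ⊆ SZ h ∪ Shalf)
    -- the five conclusions of `lines124N_of_bounds` (`dev p = |U(∂p) − 1|`)
    (htop : k₀ + 2 ≤ k → ∀ p ∈ SΩ (k - 1), SF124c (dist1 (plaqHol U p)) (cTop k k) β (E124 ε L η k k))
    (hmid : ∀ m, k₀ < m → m + 2 ≤ k → ∀ p ∈ SΩ m, SF151 (dist1 (plaqHol U p)) β (L₀ ^ (2 * (k - m - 1))) (E124 ε L η k k))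
    (hout : ∀ p ∈ SOut, SF151 (dist1 (plaqHol U p)) β ((L₀ ^ 2) ^ (k - k₀ - 1)) (E124 ε L η k k))
    (hZ : ∀ i, h ≤ i → i < k → ∀ p ∈ SZ i,
      SF149 (dist1 (plaqHol U p)) β ((1 / 2 : ℝ) ^ (k - i + 1)) ((L₀ ^ 2) ^ (i - k₀ - 1)) (E124 ε L η k i))
    (hhalf : ∀ p ∈ Shalf, SF149 (dist1 (plaqHol U p)) β ((1 / 2 : ℝ) ^ (k - h + 1)) ((L₀ ^ 2) ^ (h - k₀ - 1)) (E124 ε L η k h)) :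
    Chi124 Ω Zpp h k₀ k k β L₀ ε L η U := by
  refine ⟨fun i hi hik p hp => ?_, fun p hp => hout p (hSOut hp), fun l hl hlk p hp => hmid l hl hlk p (hSΩ l hl hlk hp),
    fun p hp => htop hk p (hStop hp)⟩
  by_cases hih : i = h
  · subst hih
    rw [region149_self] at hp
    rcases hSh hp with hp' | hp'
    · exact hZ i hi hik p hp'
    · exact hhalf p hp'
  · rw [region149_of_ne Ω Zpp hih] at hp
    exact hZ i hi hik p (hSZ i (lt_of_le_of_ne hi (Ne.symm hih)) hik hp)

/-- **(1.89) with `χ″_k` CONCRETE**: in the typed implication form `B15.BasicStep.Claim189 remaining dropped` (p. 198 *"the restrictions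
introduced by the remaining characteristic functions … imply that χ_hχ″_k = 1"*), `dropped := Chi124 … k k` (the function `χ″_k` on the
concrete regions), from the chain hypothesis of `B15Claim189Cases.claim189_of_chain`: the remaining characteristic functions imply per-
configuration bounds, and the bounds imply the five line-families on families covering the regions. [cite: Balaban1989LargeFieldI, (1.89) p.198, p.200] -/
theorem claim189_chi124 (Ω Zpp : ℕ → Set (Site P 0)) {h k₀ k : ℕ} (hk : k₀ + 2 ≤ k) {β L₀ : ℝ} {ε : ℕ → ℝ} {L η : ℝ}
    (remaining bounds : GaugeField P 0 G → Prop) (hchain : ∀ U, remaining U → bounds U)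
    (SΩ : ℕ → Set (Plaq P 0)) (SOut : Set (Plaq P 0)) (SZ : ℕ → Set (Plaq P 0)) (Shalf : Set (Plaq P 0))
    (hSΩ : ∀ m, k₀ < m → m + 2 ≤ k → plaqsOf (Ω m \ Ω (m + 1)) ⊆ SΩ m)
    (hStop : plaqsOf (Ω (k - 1) \ Ω (k + 1)) ⊆ SΩ (k - 1))
    (hSOut : plaqsOf ((Ω (k₀ + 1))ᶜ \ Zpp k) ⊆ SOut)
    (hSZ : ∀ i, h < i → i < k → plaqsOf (Zpp (i + 1) \ Zpp i) ⊆ SZ i)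
    (hSh : plaqsOf (Zpp (h + 1) ∩ Ω h) ⊆ SZ h ∪ Shalf)
    (hlines : ∀ U, bounds U →
      (k₀ + 2 ≤ k → ∀ p ∈ SΩ (k - 1), SF124c (dist1 (plaqHol U p)) (cTop k k) β (E124 ε L η k k)) ∧
      (∀ m, k₀ < m → m + 2 ≤ k → ∀ p ∈ SΩ m, SF151 (dist1 (plaqHol U p)) β (L₀ ^ (2 * (k - m - 1))) (E124 ε L η k k)) ∧
      (∀ p ∈ SOut, SF151 (dist1 (plaqHol U p)) β ((L₀ ^ 2) ^ (k - k₀ - 1)) (E124 ε L η k k)) ∧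
      (∀ i, h ≤ i → i < k → ∀ p ∈ SZ i,
        SF149 (dist1 (plaqHol U p)) β ((1 / 2 : ℝ) ^ (k - i + 1)) ((L₀ ^ 2) ^ (i - k₀ - 1)) (E124 ε L η k i)) ∧
      (∀ p ∈ Shalf, SF149 (dist1 (plaqHol U p)) β ((1 / 2 : ℝ) ^ (k - h + 1)) ((L₀ ^ 2) ^ (h - k₀ - 1)) (E124 ε L η k h))) :
    Claim189 remaining (Chi124 Ω Zpp h k₀ k k β L₀ ε L η) :=
  B15Claim189Cases.claim189_of_chain remaining bounds _ hchain fun U hU => by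
    obtain ⟨h1, h2, h3, h4, h5⟩ := hlines U hU
    exact chi124_top_of_lines Ω Zpp hk U SΩ SOut SZ Shalf hSΩ hStop hSOut hSZ hSh h1 h2 h3 h4 h5

end Literature.MathematicalPhysics.QuantumFieldTheory.Balaban1983to89.B15Chi124DetSets
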